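import Literature.NumberTheory.Automorphic.CDTTheorem712
import Literature.NumberTheory.GaloisRepresentations.ModThreeImageOrderEightAbsIrreducible
import HarnessLib

/-!
# k3 · gen 24 · elaboration sanity of the helper-lemma STATEMENTS of `STUB-IDEAS-stub_switch-3.md`
(crux `FreyModularity`, stmt-ABC-11340; stub `stub_switch`).  New at gen 24: H6
(`ModThreeOrderEight.orderEightCriterion`, lane-A file M0′) is IN THE TREE (p844123, 2026-09-01T12:04Z),
so the W5 assembly H5 → H6 → H7 → H8 is checked here against the LANDED declaration (not a copy):
(i) the registered signature is `Iff.rfl`-equal to `BCDT.CDT_three_five_switch`; (ii) H5's statement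
(= `CDTThreeFiveSwitch.Road.CDT_three_five_switch_of_orderEightCriterion`, wave W4, not yet landed) is
mocked as a `Prop` and fed the REAL tree theorem H6 — this elaborates iff the landed type of
`orderEightCriterion` is the hypothesis type `h8c` of H5 up to defeq; (iii) L7′'s verbatim header from the fact.
No proofs of mathematics here (planner seat).
-/

open Literature.NumberTheory.EllipticCurves Literature.NumberTheory.Automorphic
  Literature.NumberTheory.Automorphic.BCDT Literature.NumberTheory.GaloisRepresentations WeierstrassCurve Field

namespace StubSwitchK3G24

/-- The registered signature of `stub_switch` (skeleton sha `21576c53…`), verbatim. -/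
def StubSwitchSig : Prop :=
  ∀ (W : WeierstrassCurve ℚ) [W.IsElliptic], ¬ 27 ∣ W.conductorNorm ℤ →
      (∀ ρ₃ : ModPGaloisRep ℚ (ZMod 3) 2, W.IsTorsionGaloisRep 3 ρ₃ →
        ¬ ρ₃.IsAbsIrreducibleOverSqrt (-3)) →
      ∀ (ρ : ModPGaloisRep ℚ (ZMod 5) 2), W.IsTorsionGaloisRep 5 ρ → ρ.IsAbsIrreducibleOverSqrt 5 →
      ∃ (W' : WeierstrassCurve ℚ) (_ : W'.IsElliptic), W'.IsTorsionGaloisRep 5 ρ ∧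
        ∃ ρ₃' : ModPGaloisRep ℚ (ZMod 3) 2, W'.IsTorsionGaloisRep 3 ρ₃' ∧
          ρ₃'.IsAbsIrreducibleOverSqrt (-3)

/-- (i) stub signature ↔ the named fact, definitionally. -/
theorem stubSwitchSig_iff : StubSwitchSig ↔ CDT_three_five_switch := Iff.rfl

/-- The hypothesis type `h8c` of H5, spelled exactly as in M5 (`CDTThreeFiveSwitchProofs.lean` ll.1100–1103). -/
def H8cType : Prop :=
  ∀ (ρ : ModPGaloisRep ℚ (ZMod 3) 2),
    (∀ σ : Field.absoluteGaloisGroup ℚ, Matrix.GeneralLinearGroup.det (ρ σ) =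
      Literature.NumberTheory.GaloisRepresentations.modPCyclotomicCharacterZMod ℚ 3 σ) →
    ∀ σ₀ : Field.absoluteGaloisGroup ℚ, orderOf (ρ σ₀) = 8 → ρ.IsAbsIrreducibleOverSqrt (-3)

/-- (ii-a) H6, the LANDED tree theorem, has exactly the type `h8c` (term-mode, no unfolding tricks). -/
theorem h6_landed : H8cType :=
  _root_.Literature.NumberTheory.GaloisRepresentations.ModThreeOrderEight.orderEightCriterion

/-- H5's statement as a `Prop` (mock: W4 is not landed yet). -/
def RoadStatement : Prop := H8cType → CDT_three_five_switch

/-- (ii-b) W5's one-line assembly H7 := H5 H6, with the REAL H6. -/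
theorem fact_of_road (h5 : RoadStatement) : CDT_three_five_switch :=
  h5 _root_.Literature.NumberTheory.GaloisRepresentations.ModThreeOrderEight.orderEightCriterion

/-- (iii) L7′: the registered signature VERBATIM from the fact (δ-unfolding only). -/
theorem stub_switch_of_fact (h : CDT_three_five_switch) :
    ∀ (W : WeierstrassCurve ℚ) [W.IsElliptic], ¬ 27 ∣ W.conductorNorm ℤ →
      (∀ ρ₃ : ModPGaloisRep ℚ (ZMod 3) 2, W.IsTorsionGaloisRep 3 ρ₃ →
        ¬ ρ₃.IsAbsIrreducibleOverSqrt (-3)) →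
      ∀ (ρ : ModPGaloisRep ℚ (ZMod 5) 2), W.IsTorsionGaloisRep 5 ρ → ρ.IsAbsIrreducibleOverSqrt 5 →
      ∃ (W' : WeierstrassCurve ℚ) (_ : W'.IsElliptic), W'.IsTorsionGaloisRep 5 ρ ∧
        ∃ ρ₃' : ModPGaloisRep ℚ (ZMod 3) 2, W'.IsTorsionGaloisRep 3 ρ₃' ∧
          ρ₃'.IsAbsIrreducibleOverSqrt (-3) :=
  h

/-- End-to-end (planner-level): H5 ⇒ stub, H6 supplied by the tree. -/
theorem stub_of_road (h5 : RoadStatement) : StubSwitchSig :=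
  stubSwitchSig_iff.mpr (fact_of_road h5)

end StubSwitchK3G24
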